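import Mathlib
import Literature.Geometry.Riemannian.SphericalCylinderEntropy
import Literature.Geometry.Manifold.CylinderSlice
import HarnessLib

/-!
# Layer cake: per-level mass slack integrates to density slack

Stub `stub_layerCakeCore` of line `ball-mass-slack` of the crux `CylinderEntropy.ThinCrossSectionExists`
(`stmt-SmoothPoincare4-7633`), proved with its registered statement verbatim.  On the round cylinder
`N = {z ∈ ℝ⁶ | ∑_{i<5} zᵢ² = 1}` with Mathlib's `μH[4]`: if the typed kernel `K_{p,τ}` is dominated on `N`
by an antitone non-negative radial profile `F ∘ d_N(·,p)`, if `ofReal (F ∘ d_N(·,e₀)) ≤ ofReal K_{e₀,τ}` on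
the slice `{z ∈ N | z₅ = 0}`, and if every superlevel set satisfies
`μH⁴(S ∩ {F∘d_N(·,p) > t}) ≤ Λ · μH⁴(slice ∩ {F∘d_N(·,e₀) > t})` (`t > 0`), then
`cylDensity S p τ ≤ Λ * cylDensity slice e₀ τ`.

The proof is the abstract `lintegral` layer cake `LayerCakeCore.setLIntegral_le_mul_of_level`
(any measure space; `S` need not be measurable, only contained in a measurable `N` on which the
domination holds): dominate a.e. for `μ.restrict S` (`ae_restrict_mem`,
`ae_restrict_of_ae_restrict_of_subset`, `lintegral_mono_ae`), apply
`MeasureTheory.lintegral_eq_lintegral_meas_lt` (with `Measure.restrict_apply` on the measurable level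
sets `measurableSet_lt`), bound level by level on `Ioi 0` (`setLIntegral_mono'`), pull out `Λ`
(`lintegral_const_mul`, the level function being antitone hence measurable, `Antitone.measurable`),
run the layer cake backwards on the slice and finish with `setLIntegral_mono'`.  The instantiation
uses the measurability of `F ∘ d_N(·,p)` (`Antitone.measurable`, continuity of
`y ↦ √(arccos⟨y',p'⟩² + (y₅-p₅)²)`), of `N` (closed) and of the slice (`range_sliceMap`,
`measurableSet_range_sliceMap`), and finally multiplies by the constant `(μH⁴ S⁴)⁻¹` of `cylDensity`.

Everything here is proved; no facts and no `Prop`-valued definitions are introduced.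
-/

noncomputable section

open scoped BigOperators Topology MeasureTheory ENNReal NNReal
open Set Function MeasureTheory
open Literature.Geometry.Riemannian.SphericalCylinderEntropy (cylEntropy cylDensity cylKernel zonal wt gegen
  cylKernel_eq abs_sum_mul_le_one hausdorffMeasure_sphere_four_pos hausdorffMeasure_sphere_four_lt_top
  measurableSet_range_sliceMap)
open Literature.Geometry.Manifold.CylinderSlice (sliceMap range_sliceMap)

set_option linter.dupNamespace false

namespace Summit.SmoothPoincare4.SmoothPoincare4.Theorems.ThinCrossSectionExists.BallMassSlack

namespace LayerCakeCore

/-- Layer cake on a restricted measure, with the level sets intersected with the (possibly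
non-measurable) restricting set: `∫⁻ x in s, ofReal (f x) ∂μ = ∫⁻ t in Ioi 0, μ (s ∩ {t < f})` for a
measurable non-negative real `f`. [folklore] -/
theorem setLIntegral_ofReal_eq_lintegral_meas_lt {α : Type*} [MeasurableSpace α] (μ : Measure α)
    (s : Set α) {f : α → ℝ} (hf : Measurable f) (hf0 : ∀ x, 0 ≤ f x) :
    ∫⁻ x in s, ENNReal.ofReal (f x) ∂μ = ∫⁻ t in Ioi 0, μ (s ∩ {x | t < f x}) := by
  rw [lintegral_eq_lintegral_meas_lt (μ.restrict s) (Filter.Eventually.of_forall hf0) hf.aemeasurable]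
  refine lintegral_congr fun t => ?_
  rw [Measure.restrict_apply (measurableSet_lt measurable_const hf), Set.inter_comm]

/-- The level-set measure `t ↦ μ (s ∩ {t < f})` is antitone in the level. [folklore] -/
theorem antitone_meas_inter_lt {α : Type*} [MeasurableSpace α] (μ : Measure α) (s : Set α)
    (f : α → ℝ) : Antitone fun t : ℝ => μ (s ∩ {x | t < f x}) :=
  fun _ t₂ ht => measure_mono (Set.inter_subset_inter_right _ fun x (hx : t₂ < f x) => lt_of_le_of_lt ht hx)

/-- **Abstract layer-cake core.**  In any measure space: if `S ⊆ N` with `N` measurable, `T` is measurable,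
`K ≤ f` on `N`, `ofReal f₀ ≤ ofReal K₀` on `T`, `f, f₀` are measurable and non-negative, and the superlevel
sets satisfy `μ (S ∩ {t < f}) ≤ Λ * μ (T ∩ {t < f₀})` for all `t > 0`, then
`∫⁻ S, ofReal K ∂μ ≤ Λ * ∫⁻ T, ofReal K₀ ∂μ`.  (`S` need not be measurable.) [folklore] -/
theorem setLIntegral_le_mul_of_level {α : Type*} [MeasurableSpace α] (μ : Measure α) (Λ : ℝ≥0∞)
    {S N T : Set α} (hSN : S ⊆ N) (hN : MeasurableSet N) (hT : MeasurableSet T)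
    {K K₀ f f₀ : α → ℝ} (hf : Measurable f) (hf₀ : Measurable f₀)
    (hf0 : ∀ y, 0 ≤ f y) (hf₀0 : ∀ y, 0 ≤ f₀ y)
    (hdom : ∀ y ∈ N, K y ≤ f y) (hex : ∀ y ∈ T, ENNReal.ofReal (f₀ y) ≤ ENNReal.ofReal (K₀ y))
    (hlev : ∀ t : ℝ, 0 < t → μ (S ∩ {y | t < f y}) ≤ Λ * μ (T ∩ {y | t < f₀ y})) :
    ∫⁻ y in S, ENNReal.ofReal (K y) ∂μ ≤ Λ * ∫⁻ y in T, ENNReal.ofReal (K₀ y) ∂μ := by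
  have haeN : ∀ᵐ y ∂μ.restrict S, y ∈ N :=
    ae_restrict_of_ae_restrict_of_subset hSN (ae_restrict_mem hN)
  calc ∫⁻ y in S, ENNReal.ofReal (K y) ∂μ
      ≤ ∫⁻ y in S, ENNReal.ofReal (f y) ∂μ :=
        lintegral_mono_ae (haeN.mono fun y hy => ENNReal.ofReal_le_ofReal (hdom y hy))
    _ = ∫⁻ t in Ioi 0, μ (S ∩ {y | t < f y}) := setLIntegral_ofReal_eq_lintegral_meas_lt μ S hf hf0
    _ ≤ ∫⁻ t in Ioi 0, Λ * μ (T ∩ {y | t < f₀ y}) :=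
        setLIntegral_mono' measurableSet_Ioi fun t ht => hlev t ht
    _ = Λ * ∫⁻ t in Ioi 0, μ (T ∩ {y | t < f₀ y}) :=
        lintegral_const_mul Λ (antitone_meas_inter_lt μ T f₀).measurable
    _ = Λ * ∫⁻ y in T, ENNReal.ofReal (f₀ y) ∂μ := by
        rw [setLIntegral_ofReal_eq_lintegral_meas_lt μ T hf₀ hf₀0]
    _ ≤ Λ * ∫⁻ y in T, ENNReal.ofReal (K₀ y) ∂μ :=
        mul_le_mul_right (setLIntegral_mono' hT hex) Λ

/-- The inlined intrinsic distance `y ↦ √(arccos⟨y',p'⟩² + (y₅ - p₅)²)` to a fixed centre `p` is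
continuous on `ℝ⁶`. [folklore] -/
theorem continuous_intrDist (p : EuclideanSpace ℝ (Fin 6)) :
    Continuous fun y : EuclideanSpace ℝ (Fin 6) =>
      Real.sqrt (Real.arccos (∑ i : Fin 5, y (Fin.castSucc i) * p (Fin.castSucc i)) ^ 2 +
        (y 5 - p 5) ^ 2) := by
  fun_prop

/-- An antitone profile of the inlined intrinsic distance is measurable on `ℝ⁶`. [folklore] -/
theorem measurable_profile {F : ℝ → ℝ} (hFa : Antitone F) (p : EuclideanSpace ℝ (Fin 6)) :
    Measurable fun y : EuclideanSpace ℝ (Fin 6) =>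
      F (Real.sqrt (Real.arccos (∑ i : Fin 5, y (Fin.castSucc i) * p (Fin.castSucc i)) ^ 2 +
        (y 5 - p 5) ^ 2)) :=
  hFa.measurable.comp (continuous_intrDist p).measurable

/-- The round cylinder `N = {∑_{i<5} zᵢ² = 1} ⊂ ℝ⁶` is measurable (it is closed). [folklore] -/
theorem measurableSet_cylinder :
    MeasurableSet {y : EuclideanSpace ℝ (Fin 6) | ∑ i : Fin 5, y (Fin.castSucc i) ^ 2 = 1} :=
  (isClosed_eq (f := fun y : EuclideanSpace ℝ (Fin 6) => ∑ i : Fin 5, y (Fin.castSucc i) ^ 2)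
    (g := fun _ => (1 : ℝ)) (by fun_prop) continuous_const).measurableSet

/-- The slice `{z ∈ N | z₅ = 0}` is measurable (it is the range of the slice embedding). [folklore] -/
theorem measurableSet_slice₀ :
    MeasurableSet {z : EuclideanSpace ℝ (Fin 6) | ∑ i : Fin 5, z (Fin.castSucc i) ^ 2 = 1 ∧ z 5 = 0} := by
  rw [← range_sliceMap]
  exact measurableSet_range_sliceMap 0

end LayerCakeCore

/-- **Stub C-core of line `ball-mass-slack`** (the `lintegral` layer cake).  Given `S ⊆ N`, a centre
`p ∈ N`, a scale `τ`, an antitone non-negative profile `F` with `K_{p,τ} ≤ F ∘ d_N(·,p)` on `N` and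
`ofReal (F ∘ d_N(·,e₀)) ≤ ofReal K_{e₀,τ}` on the slice `{z ∈ N | z₅ = 0}`, the per-level slack
`μH⁴(S ∩ {F∘d_N(·,p) > t}) ≤ Λ·μH⁴(slice ∩ {F∘d_N(·,e₀) > t})` (`t > 0`) integrates to
`cylDensity S p τ ≤ Λ * cylDensity slice e₀ τ`. [folklore] -/
theorem stub_layerCakeCore :
    ∀ (τ : ℝ) (Λ : ℝ≥0∞) (S : Set (EuclideanSpace ℝ (Fin 6))) (F : ℝ → ℝ) (p : EuclideanSpace ℝ (Fin 6)),
      (∀ y ∈ S, ∑ i : Fin 5, y (Fin.castSucc i) ^ 2 = 1) →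
      Antitone F → (∀ r : ℝ, 0 ≤ F r) → ∑ i : Fin 5, p (Fin.castSucc i) ^ 2 = 1 →
      (∀ y : EuclideanSpace ℝ (Fin 6), ∑ i : Fin 5, y (Fin.castSucc i) ^ 2 = 1 → cylKernel p τ y ≤ F (Real.sqrt (Real.arccos (∑ i : Fin 5, y (Fin.castSucc i) * p (Fin.castSucc i)) ^ 2 + (y 5 - p 5) ^ 2))) →
      (∀ y : EuclideanSpace ℝ (Fin 6), ∑ i : Fin 5, y (Fin.castSucc i) ^ 2 = 1 → y 5 = 0 →
            ENNReal.ofReal (F (Real.sqrt (Real.arccos (∑ i : Fin 5, y (Fin.castSucc i) * (EuclideanSpace.single 0 1 : EuclideanSpace ℝ (Fin 6)) (Fin.castSucc i)) ^ 2 + (y 5 - (EuclideanSpace.single 0 1 : EuclideanSpace ℝ (Fin 6)) 5) ^ 2))) ≤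
              ENNReal.ofReal (cylKernel (EuclideanSpace.single 0 1 : EuclideanSpace ℝ (Fin 6)) τ y)) →
      (∀ t : ℝ, 0 < t →
          μH[4] (S ∩ {y : EuclideanSpace ℝ (Fin 6) | t < F (Real.sqrt (Real.arccos (∑ i : Fin 5, y (Fin.castSucc i) * p (Fin.castSucc i)) ^ 2 + (y 5 - p 5) ^ 2))}) ≤
            Λ * μH[4] ({z : EuclideanSpace ℝ (Fin 6) | ∑ i : Fin 5, z (Fin.castSucc i) ^ 2 = 1 ∧ z 5 = 0} ∩ {y : EuclideanSpace ℝ (Fin 6) | t < F (Real.sqrt (Real.arccos (∑ i : Fin 5, y (Fin.castSucc i) * (EuclideanSpace.single 0 1 : EuclideanSpace ℝ (Fin 6)) (Fin.castSucc i)) ^ 2 + (y 5 - (EuclideanSpace.single 0 1 : EuclideanSpace ℝ (Fin 6)) 5) ^ 2))})) →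
        cylDensity S p τ ≤ Λ * cylDensity {z : EuclideanSpace ℝ (Fin 6) | ∑ i : Fin 5, z (Fin.castSucc i) ^ 2 = 1 ∧ z 5 = 0} (EuclideanSpace.single 0 1 : EuclideanSpace ℝ (Fin 6)) τ := by
  intro τ Λ S F p hS hFa hF0 _hp hdom hex hlev
  have key : ∫⁻ y in S, ENNReal.ofReal (cylKernel p τ y) ∂μH[4] ≤
      Λ * ∫⁻ y in {z : EuclideanSpace ℝ (Fin 6) | ∑ i : Fin 5, z (Fin.castSucc i) ^ 2 = 1 ∧ z 5 = 0},
        ENNReal.ofReal (cylKernel (EuclideanSpace.single 0 1 : EuclideanSpace ℝ (Fin 6)) τ y) ∂μH[4] :=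
    LayerCakeCore.setLIntegral_le_mul_of_level μH[4] Λ
      (N := {y : EuclideanSpace ℝ (Fin 6) | ∑ i : Fin 5, y (Fin.castSucc i) ^ 2 = 1})
      (f := fun y : EuclideanSpace ℝ (Fin 6) =>
        F (Real.sqrt (Real.arccos (∑ i : Fin 5, y (Fin.castSucc i) * p (Fin.castSucc i)) ^ 2 +
          (y 5 - p 5) ^ 2)))
      (f₀ := fun y : EuclideanSpace ℝ (Fin 6) =>
        F (Real.sqrt (Real.arccos (∑ i : Fin 5, y (Fin.castSucc i) *
          (EuclideanSpace.single 0 1 : EuclideanSpace ℝ (Fin 6)) (Fin.castSucc i)) ^ 2 +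
          (y 5 - (EuclideanSpace.single 0 1 : EuclideanSpace ℝ (Fin 6)) 5) ^ 2)))
      (fun y hy => hS y hy) LayerCakeCore.measurableSet_cylinder LayerCakeCore.measurableSet_slice₀
      (LayerCakeCore.measurable_profile hFa p) (LayerCakeCore.measurable_profile hFa _)
      (fun _ => hF0 _) (fun _ => hF0 _) (fun y hy => hdom y hy) (fun y hy => hex y hy.1 hy.2) hlev
  rw [cylDensity, cylDensity]
  calc (μH[4] (Metric.sphere (0 : EuclideanSpace ℝ (Fin 5)) 1))⁻¹ *
        ∫⁻ y in S, ENNReal.ofReal (cylKernel p τ y) ∂μH[4]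
      ≤ (μH[4] (Metric.sphere (0 : EuclideanSpace ℝ (Fin 5)) 1))⁻¹ *
        (Λ * ∫⁻ y in {z : EuclideanSpace ℝ (Fin 6) | ∑ i : Fin 5, z (Fin.castSucc i) ^ 2 = 1 ∧ z 5 = 0},
          ENNReal.ofReal (cylKernel (EuclideanSpace.single 0 1 : EuclideanSpace ℝ (Fin 6)) τ y) ∂μH[4]) :=
        mul_le_mul_right key _
    _ = _ := mul_left_comm _ _ _

end Summit.SmoothPoincare4.SmoothPoincare4.Theorems.ThinCrossSectionExists.BallMassSlack
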